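import Mathlib.RingTheory.RootsOfUnity.PrimitiveRoots
import Summits.MatrixMultiplication.OmegaCensus.DominoLineUnitObstruction

/-!
# The unit obstruction to the normalised line identity over `ZMod m` for COMPOSITE odd moduli `m` coprime to `6`

ω-census `pub-omega`, family (b3), seat pub-omega-stpp-1 gen 23 (lead ruling L32-17 (1)).  Framing: lottery ticket; floor =
certified bounds/negative ranges.  VALUE: the kernel form of the "unit test" of `DominoLineUnitObstruction` (there: `ZMod p`, `p ≥ 5`
prime) for an arbitrary modulus `m` with `gcd(m, 6) = 1`, `m > 1` — so that the census step (1) of the group lane for the composite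
cyclic quotients `ℤ₂₅, ℤ₃₅, ℤ₆₅, …` (NR207 / NR211 / NR213, 'on paper for composite m') is kernel-backed; NOT progress on ω.

Setting (`DominoLineCertificate.line_identity_of_shifted_form`, any `[NeZero m]`): `F, G : ZMod m → ℕ`, `s`, `K` with
`Σ_v (F(τ−v) + F(v−τ) + F(τ+v))·G(v) + [s = τ] = K` for every `τ : ZMod m`.

THE HYPOTHESIS ON `r` (the lead's first option).  For a prime `p` the single relation `Σ_{i<p} r^i = 0` implies `Σ_{i<p} r^{ki} = 0`
for every `k ≢ 0`; for composite `m` it does not (`k` need not be invertible), so we ASSUME it: `AllGeomZero m r` :=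
`∀ k : ZMod m, k ≠ 0 → Σ_{i<m} (r^{k})^i = 0` (with `r^k = zch r k = r ^ k.val`).  It holds for every PRIMITIVE `m`-th root of unity
in a domain (`allGeomZero_of_isPrimitiveRoot`: `ζ^k ≠ 1` and `(ζ^k)^m = 1` give `(ζ^k − 1)·Σ = 0`), in particular for `ζ_m ∈ ℤ[ζ_m]`
and for an element of multiplicative order `m` in a prime field `ZMod q` — which is what the numerical certificates use.

* `LineM.line_char_identity` / `_conj`: `ab + āb + ab̄ + r^s = 0` and `āb̄ + ab̄ + āb + r^{−s} = 0` for `a = Σ F(v) r^v`,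
  `ā = Σ F(v) r^{−v}`, `b, b̄` likewise (only `Σ_{i<m} r^i = 0` is used here).
* **`LineM.isUnit_lineD_of_line_identity`**: `gcd(m,6) = 1`, `1 < m`, `AllGeomZero m r` and a solution `G, s, K` ⇒ `a² + aā + ā²`
  is a UNIT of `R`.  Same algebra as the prime case: `(a²+aā+ā²)(b²+bb̄+b̄²) = z² − 1 + z̄²` (`z = r^s`), and
  `(z² − 1 + z̄²)·z²·(1 + z²) = 1 + z⁶`; `1 + r^{2s}` and `1 + r^{6s}` are units for `s ≠ 0` because `2` and `6` are units of `ZMod m`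
  (so `2s, 6s ≠ 0`) and `1 + y` is a unit whenever `Σ_{i<m} y^i = 0` with `m` odd.
* `LineM.no_line_identity_of_lineD_eq_zero`, the `Bool` checker **`LineM.unitCert`** (`(q, r)`: `1 < q`, `Σ_{i<m} r^{ki} ≡ 0 (mod q)`
  for every `0 < k < m`, `A² + AB + B² ≡ 0 (mod q)`) with **`LineM.unitCert_sound`**, and the domain form
  **`LineM.isUnit_lineD_of_isPrimitiveRoot`**.
-/

namespace Summit.MatrixMultiplication.OmegaCensus

open Finset

namespace LineM

/-! ## Exponentials on `ZMod m` -/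

section Exponential

variable {m : ℕ} [NeZero m] {R : Type*} [CommRing R]

/-- Multiplicativity of `zch` when `r^m = 1`. [folklore] -/
theorem zch_add {r : R} (h : r ^ m = 1) (v w : ZMod m) : zch r (v + w) = zch r v * zch r w := by
  rw [zch, zch, zch, ZMod.val_add, pow_mod_eq_pow h, pow_add]

/-- `zch r v · zch r (−v) = 1` when `r^m = 1`. [folklore] -/
theorem zch_mul_zch_neg {r : R} (h : r ^ m = 1) (v : ZMod m) : zch r v * zch r (-v) = 1 := by
  rw [← zch_add h, add_neg_cancel, zch, ZMod.val_zero, pow_zero]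

/-- Powers: `(zch r v)^n = zch r (n v)` when `r^m = 1`. [folklore] -/
theorem zch_pow {r : R} (h : r ^ m = 1) (v : ZMod m) (n : ℕ) : zch r v ^ n = zch r ((n : ZMod m) * v) := by
  induction n with
  | zero => rw [pow_zero, Nat.cast_zero, zero_mul, zch, ZMod.val_zero, pow_zero]
  | succ n ih => rw [pow_succ, ih, Nat.cast_succ, add_mul, one_mul, zch_add h]

/-- A sum over `ZMod m` of a function of `val` is the sum over `range m`. [folklore] -/
theorem sum_val_eq_sum_range {M : Type*} [AddCommMonoid M] (f : ℕ → M) : ∑ τ : ZMod m, f τ.val = ∑ i ∈ range m, f i := by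
  refine Finset.sum_bij (fun τ _ => τ.val) (fun τ _ => mem_range.2 (ZMod.val_lt τ))
    (fun a _ b _ hab => ZMod.val_injective m hab) (fun i hi => ?_) (fun τ _ => rfl)
  exact ⟨(i : ZMod m), mem_univ _, ZMod.val_cast_of_lt (mem_range.1 hi)⟩

/-- `Σ_τ zch r τ = Σ_{i<m} r^i`. [folklore] -/
theorem sum_zch (r : R) : ∑ τ : ZMod m, zch r τ = ∑ i ∈ range m, r ^ i := sum_val_eq_sum_range (fun i => r ^ i)

/-- THE HYPOTHESIS: every non-trivial power `y = r^k` (`k ≢ 0 mod m`) has `Σ_{i<m} y^i = 0`. [folklore] -/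
def AllGeomZero (m : ℕ) [NeZero m] (r : R) : Prop := ∀ k : ZMod m, k ≠ 0 → ∑ i ∈ range m, (zch r k) ^ i = 0

/-- In particular `Σ_{i<m} r^i = 0` (`k = 1`, `m > 1`). [folklore] -/
theorem AllGeomZero.geom_sum (hm : 1 < m) {r : R} (h : AllGeomZero m r) : ∑ i ∈ range m, r ^ i = 0 := by
  haveI : Fact (1 < m) := ⟨hm⟩
  have := h 1 one_ne_zero
  rwa [zch, ZMod.val_one, pow_one] at this

omit [NeZero m] in
/-- `1 + y` is a unit when `Σ_{i<m} y^i = 0` with `m` odd: `(1 + y)·(−Σ_{j<(m−1)/2} y^{2j+1}) = 1`. [folklore] -/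
theorem isUnit_one_add_of_geom_sum_eq_zero (hodd : Odd m) {y : R} (hy : ∑ i ∈ range m, y ^ i = 0) : IsUnit (1 + y) := by
  obtain ⟨n, hn⟩ := hodd
  rw [hn] at hy
  have key := one_add_mul_odd_geom_sum y n
  rw [hy, zero_sub] at key
  refine IsUnit.of_mul_eq_one (-(∑ j ∈ range n, y ^ (2 * j + 1))) ?_
  rw [mul_neg, key, neg_neg]

/-- A primitive `m`-th root of unity in a domain satisfies the hypothesis. [folklore] -/
theorem allGeomZero_of_isPrimitiveRoot [IsDomain R] {ζ : R} (hζ : IsPrimitiveRoot ζ m) : AllGeomZero m ζ := by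
  intro k hk
  have hk0 : 0 < k.val := Nat.pos_of_ne_zero fun h => hk ((ZMod.val_eq_zero k).1 h)
  have hne : zch ζ k ≠ 1 := hζ.pow_ne_one_of_pos_of_lt hk0.ne' (ZMod.val_lt k)
  have hpow : zch ζ k ^ m = 1 := by rw [zch, ← pow_mul, mul_comm, pow_mul, hζ.pow_eq_one, one_pow]
  have h := geom_sum_mul (zch ζ k) m
  rw [hpow, sub_self] at h
  exact (mul_eq_zero.1 h).resolve_right (sub_ne_zero.2 hne)

end Exponential

/-! ## The character identity over `ZMod m` -/

section Character

variable {m : ℕ} [NeZero m] {R : Type*} [CommRing R]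

/-- `a = Σ_v F(v) r^v`. [folklore] -/
def lev (r : R) (F : ZMod m → ℕ) : R := ∑ v : ZMod m, (F v : R) * zch r v

/-- `ā = Σ_v F(v) r^{−v}`. [folklore] -/
def levc (r : R) (F : ZMod m → ℕ) : R := ∑ v : ZMod m, (F v : R) * zch r (-v)

/-- Reflection turns `lev` into `levc`. [folklore] -/
theorem lev_reflect (r : R) (F : ZMod m → ℕ) : lev r (fun v => F (-v)) = levc r F := by
  unfold lev levc
  exact Fintype.sum_equiv (Equiv.neg (ZMod m)) _ _ fun v => by simp

/-- Reflection turns `levc` into `lev`. [folklore] -/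
theorem levc_reflect (r : R) (F : ZMod m → ℕ) : levc r (fun v => F (-v)) = lev r F := by
  unfold lev levc
  exact Fintype.sum_equiv (Equiv.neg (ZMod m)) _ _ fun v => by simp

/-- **The line identity through `v ↦ r^v`**: `ab + āb + ab̄ + r^s = 0`, from `Σ_{i<m} r^i = 0` alone. [folklore] -/
theorem line_char_identity {r : R} (hr : ∑ i ∈ range m, r ^ i = 0) (F G : ZMod m → ℕ) (s : ZMod m) (K : ℕ)
    (hid : ∀ τ : ZMod m, (∑ v : ZMod m, (F (τ - v) + F (v - τ) + F (τ + v)) * G v) + (if s = τ then 1 else 0) = K) :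
    lev r F * lev r G + levc r F * lev r G + lev r F * levc r G + zch r s = 0 := by
  have h1 := pow_eq_one_of_geom_sum_eq_zero hr
  have key : ∀ τ : ZMod m, (∑ v : ZMod m, (F (τ - v) : R) * G v * zch r τ) +
      (∑ v : ZMod m, (F (v - τ) : R) * G v * zch r τ) + (∑ v : ZMod m, (F (τ + v) : R) * G v * zch r τ) +
      (if s = τ then (1 : R) else 0) * zch r τ = (K : R) * zch r τ := by
    intro τ
    have h := congrArg (fun n : ℕ => (n : R) * zch r τ) (hid τ)
    push_cast at h
    rw [← h]
    simp only [add_mul, sum_mul, sum_add_distrib]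
  have hsum := sum_congr rfl fun τ (_ : τ ∈ (univ : Finset (ZMod m))) => key τ
  rw [← mul_sum, sum_zch, hr, mul_zero, sum_add_distrib, sum_add_distrib, sum_add_distrib] at hsum
  have e1 : ∑ τ : ZMod m, ∑ v : ZMod m, (F (τ - v) : R) * G v * zch r τ = lev r F * lev r G := by
    unfold lev
    conv_rhs => rw [sum_mul_sum, sum_comm]
    rw [sum_comm]
    refine sum_congr rfl fun v _ => ?_
    rw [Fintype.sum_equiv (Equiv.subRight v) (fun τ => (F (τ - v) : R) * G v * zch r τ)
      (fun w => (F w : R) * G v * zch r (w + v)) fun τ => by simp]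
    exact sum_congr rfl fun w _ => by rw [zch_add h1]; ring
  have e2 : ∑ τ : ZMod m, ∑ v : ZMod m, (F (v - τ) : R) * G v * zch r τ = levc r F * lev r G := by
    unfold lev levc
    conv_rhs => rw [sum_mul_sum, sum_comm]
    rw [sum_comm]
    refine sum_congr rfl fun v _ => ?_
    rw [Fintype.sum_equiv (Equiv.subLeft v) (fun τ => (F (v - τ) : R) * G v * zch r τ)
      (fun w => (F w : R) * G v * zch r (v - w)) fun τ => by simp]
    exact sum_congr rfl fun w _ => by rw [sub_eq_add_neg, zch_add h1]; ring
  have e3 : ∑ τ : ZMod m, ∑ v : ZMod m, (F (τ + v) : R) * G v * zch r τ = lev r F * levc r G := by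
    unfold lev levc
    conv_rhs => rw [sum_mul_sum, sum_comm]
    rw [sum_comm]
    refine sum_congr rfl fun v _ => ?_
    rw [Fintype.sum_equiv (Equiv.addRight v) (fun τ => (F (τ + v) : R) * G v * zch r τ)
      (fun w => (F w : R) * G v * zch r (w - v)) fun τ => by simp]
    exact sum_congr rfl fun w _ => by rw [sub_eq_add_neg, zch_add h1]; ring
  have e4 : ∑ τ : ZMod m, (if s = τ then (1 : R) else 0) * zch r τ = zch r s := by
    simp only [ite_mul, one_mul, zero_mul, sum_ite_eq, mem_univ, if_true]
  rw [e1, e2, e3, e4] at hsum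
  exact hsum

/-- **The conjugate identity** `āb̄ + ab̄ + āb + r^{−s} = 0`. [folklore] -/
theorem line_char_identity_conj {r : R} (hr : ∑ i ∈ range m, r ^ i = 0) (F G : ZMod m → ℕ) (s : ZMod m) (K : ℕ)
    (hid : ∀ τ : ZMod m, (∑ v : ZMod m, (F (τ - v) + F (v - τ) + F (τ + v)) * G v) + (if s = τ then 1 else 0) = K) :
    levc r F * levc r G + lev r F * levc r G + levc r F * lev r G + zch r (-s) = 0 := by
  have hid' : ∀ τ : ZMod m, (∑ v : ZMod m, (F (-(τ - v)) + F (-(v - τ)) + F (-(τ + v))) * G (-v)) +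
      (if -s = τ then 1 else 0) = K := by
    intro τ
    rw [← hid (-τ)]
    congr 1
    · refine Fintype.sum_equiv (Equiv.neg (ZMod m)) _ _ fun v => ?_
      rw [Equiv.neg_apply, show -(τ - v) = -τ - -v by abel, show -(v - τ) = -v - -τ by abel,
        show -(τ + v) = -τ + -v by abel]
    · by_cases h : s = -τ
      · rw [if_pos h, if_pos (by rw [h, neg_neg])]
      · rw [if_neg h, if_neg (fun h' => h (by rw [← h', neg_neg]))]
  have key := line_char_identity hr (fun v => F (-v)) (fun v => G (-v)) (-s) K hid'
  rw [lev_reflect, lev_reflect, levc_reflect, levc_reflect] at key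
  linear_combination key

omit [NeZero m] in
/-- `gcd(m, 6) = 1`: `m` is odd. [folklore] -/
theorem odd_of_coprime_six (hm6 : Nat.Coprime m 6) : Odd m := by
  rcases Nat.even_or_odd m with ⟨k, hk⟩ | h
  · exfalso
    have h2 : 2 ∣ Nat.gcd m 6 := Nat.dvd_gcd ⟨k, by omega⟩ (by norm_num)
    rw [hm6] at h2
    exact absurd (Nat.le_of_dvd one_pos h2) (by norm_num)
  · exact h

omit [NeZero m] in
/-- `gcd(m, 6) = 1`: `n` is a unit of `ZMod m` for `n ∣ 6`. [folklore] -/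
theorem isUnit_cast_of_dvd_six (hm6 : Nat.Coprime m 6) {n : ℕ} (hn : n ∣ 6) : IsUnit ((n : ℕ) : ZMod m) := by
  have hcop : Nat.Coprime n m := (Nat.Coprime.coprime_dvd_left hn hm6.symm)
  rw [← ZMod.coe_unitOfCoprime n hcop]
  exact Units.isUnit _

/-- **The unit obstruction over `ZMod m`, `gcd(m,6) = 1`, `m > 1`.**  If the normalised line identity has a solution `G, s, K`,
then for every `r` in a commutative ring with `AllGeomZero m r` (all non-trivial powers have vanishing geometric sums),
`a² + aā + ā²` is a unit (`a = Σ F(v) r^v`, `ā = Σ F(v) r^{−v}`). [folklore] -/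
theorem isUnit_lineD_of_line_identity (hm6 : Nat.Coprime m 6) (hm1 : 1 < m) {r : R} (hr : AllGeomZero m r)
    (F G : ZMod m → ℕ) (s : ZMod m) (K : ℕ)
    (hid : ∀ τ : ZMod m, (∑ v : ZMod m, (F (τ - v) + F (v - τ) + F (τ + v)) * G v) + (if s = τ then 1 else 0) = K) :
    IsUnit ((lev r F) ^ 2 + lev r F * levc r F + (levc r F) ^ 2) := by
  have hr1 := hr.geom_sum hm1
  have h1 := pow_eq_one_of_geom_sum_eq_zero hr1
  have hodd := odd_of_coprime_six hm6
  set a := lev r F with ha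
  set a' := levc r F with ha'
  set b := lev r G with hb
  set b' := levc r G with hb'
  set z := zch r s with hz
  set z' := zch r (-s) with hz'
  have hu : a * b + a' * b + a * b' = -z := eq_neg_of_add_eq_zero_left (line_char_identity hr1 F G s K hid)
  have hu' : a' * b' + a * b' + a' * b = -z' := eq_neg_of_add_eq_zero_left (line_char_identity_conj hr1 F G s K hid)
  have hzz : z * z' = 1 := zch_mul_zch_neg h1 s
  have hprod : (a ^ 2 + a * a' + a' ^ 2) * (b ^ 2 + b * b' + b' ^ 2) = z ^ 2 - 1 + z' ^ 2 := by
    rw [lineD_mul_lineD, hu, hu']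
    linear_combination -hzz
  have hunit : IsUnit (z ^ 2 - 1 + z' ^ 2) := by
    by_cases hs : s = 0
    · have hz1 : z = 1 := by rw [hz, hs, zch, ZMod.val_zero, pow_zero]
      have hz1' : z' = 1 := by rw [hz', hs, neg_zero, zch, ZMod.val_zero, pow_zero]
      rw [hz1, hz1']; norm_num
    · have h2u : IsUnit (2 : ZMod m) := by
        have := isUnit_cast_of_dvd_six hm6 (n := 2) (by norm_num); simpa using this
      have h6u : IsUnit (6 : ZMod m) := by
        have := isUnit_cast_of_dvd_six hm6 (n := 6) (by norm_num); simpa using this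
      have h2s : (2 : ZMod m) * s ≠ 0 := fun h => hs ((h2u.mul_right_eq_zero).1 h)
      have h6s : (6 : ZMod m) * s ≠ 0 := fun h => hs ((h6u.mul_right_eq_zero).1 h)
      have hx : z ^ 2 = zch r (2 * s) := by rw [hz, zch_pow h1]; norm_num
      have hx3 : z ^ 6 = zch r (6 * s) := by rw [hz, zch_pow h1]; norm_num
      have hunit2 : IsUnit (1 + z ^ 2) := by
        rw [hx]; exact isUnit_one_add_of_geom_sum_eq_zero hodd (hr _ h2s)
      have hunit6 : IsUnit (1 + z ^ 6) := by
        rw [hx3]; exact isUnit_one_add_of_geom_sum_eq_zero hodd (hr _ h6s)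
      have hfac : (z ^ 2 - 1 + z' ^ 2) * (z ^ 2 * (1 + z ^ 2)) = 1 + z ^ 6 := by
        have hz'2 : z' ^ 2 * z ^ 2 = 1 := by linear_combination (z * z' + 1) * hzz
        linear_combination (1 + z ^ 2) * hz'2
      rw [← hfac] at hunit6
      exact isUnit_of_mul_isUnit_left hunit6
  rw [← hprod] at hunit
  exact isUnit_of_mul_isUnit_left hunit

/-- **No line identity when `a² + aā + ā² = 0`** for some `r` with `AllGeomZero m r` in a nontrivial commutative ring. [folklore] -/
theorem no_line_identity_of_lineD_eq_zero [Nontrivial R] (hm6 : Nat.Coprime m 6) (hm1 : 1 < m) {r : R}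
    (hr : AllGeomZero m r) (F : ZMod m → ℕ) (hD : (lev r F) ^ 2 + lev r F * levc r F + (levc r F) ^ 2 = 0)
    (G : ZMod m → ℕ) (s : ZMod m) (K : ℕ)
    (hid : ∀ τ : ZMod m, (∑ v : ZMod m, (F (τ - v) + F (v - τ) + F (τ + v)) * G v) + (if s = τ then 1 else 0) = K) :
    False := by
  have h := isUnit_lineD_of_line_identity hm6 hm1 hr F G s K hid
  rw [hD] at h
  exact not_isUnit_zero h

/-- **Domain form.**  For a primitive `m`-th root of unity `ζ` in a domain (`ζ_m ∈ ℤ[ζ_m]`, or an element of order `m` in a prime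
field), a solution of the line identity forces `a² + aā + ā²` to be a unit. [folklore] -/
theorem isUnit_lineD_of_isPrimitiveRoot [IsDomain R] (hm6 : Nat.Coprime m 6) (hm1 : 1 < m) {ζ : R}
    (hζ : IsPrimitiveRoot ζ m) (F G : ZMod m → ℕ) (s : ZMod m) (K : ℕ)
    (hid : ∀ τ : ZMod m, (∑ v : ZMod m, (F (τ - v) + F (v - τ) + F (τ + v)) * G v) + (if s = τ then 1 else 0) = K) :
    IsUnit ((lev ζ F) ^ 2 + lev ζ F * levc ζ F + (levc ζ F) ^ 2) :=
  isUnit_lineD_of_line_identity hm6 hm1 (allGeomZero_of_isPrimitiveRoot hζ) F G s K hid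

end Character

/-! ## The two-number certificate `(q, r)` for composite `m` and its `Bool` checker -/

section Cert

variable {m : ℕ} [NeZero m]

/-- `A = Σ_v F(v)·r^{v}` in `ℕ`. [folklore] -/
def levNat (F : ZMod m → ℕ) (r : ℕ) : ℕ := ∑ v : ZMod m, F v * r ^ v.val

/-- `B = Σ_v F(v)·r^{(−v)}` in `ℕ`. [folklore] -/
def levcNat (F : ZMod m → ℕ) (r : ℕ) : ℕ := ∑ v : ZMod m, F v * r ^ (-v).val

/-- **Unit-test certificate check** `(q, r)` for a line key `F` over `ZMod m`: `1 < q`; `Σ_{i<m} r^{k i} ≡ 0 (mod q)` for EVERY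
`0 < k < m`; and `A² + AB + B² ≡ 0 (mod q)`. [folklore] -/
def unitCert (m : ℕ) [NeZero m] (F : ZMod m → ℕ) (q r : ℕ) : Bool :=
  decide (1 < q ∧ (∀ k ∈ range m, k ≠ 0 → (∑ i ∈ range m, r ^ (k * i)) % q = 0) ∧
    ((levNat F r) ^ 2 + levNat F r * levcNat F r + (levcNat F r) ^ 2) % q = 0)

/-- **Soundness of the certificate** (`gcd(m,6) = 1`, `m > 1`): `unitCert m F q r = true` excludes every solution `G, s, K` of the
normalised line identity with key `F`. [folklore] -/
theorem unitCert_sound (hm6 : Nat.Coprime m 6) (hm1 : 1 < m) {F : ZMod m → ℕ} {q r : ℕ} (h : unitCert m F q r = true)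
    (G : ZMod m → ℕ) (s : ZMod m) (K : ℕ)
    (hid : ∀ τ : ZMod m, (∑ v : ZMod m, (F (τ - v) + F (v - τ) + F (τ + v)) * G v) + (if s = τ then 1 else 0) = K) :
    False := by
  obtain ⟨hq, hr, hD⟩ := of_decide_eq_true h
  haveI : Fact (1 < q) := ⟨hq⟩
  have hr' : AllGeomZero m ((r : ZMod q)) := by
    intro k hk
    have hk' : k.val ≠ 0 := fun e => hk ((ZMod.val_eq_zero k).1 e)
    have e := (ZMod.natCast_eq_zero_iff _ q).2 (Nat.dvd_of_mod_eq_zero (hr k.val (mem_range.2 (ZMod.val_lt k)) hk'))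
    push_cast at e
    rw [← e]
    refine sum_congr rfl fun i _ => ?_
    rw [zch, ← pow_mul]
  have hlev : lev (r : ZMod q) F = ((levNat F r : ℕ) : ZMod q) := by
    unfold lev levNat zch; push_cast; rfl
  have hlevc : levc (r : ZMod q) F = ((levcNat F r : ℕ) : ZMod q) := by
    unfold levc levcNat zch; push_cast; rfl
  refine no_line_identity_of_lineD_eq_zero hm6 hm1 hr' F ?_ G s K hid
  rw [hlev, hlevc]
  have e := (ZMod.natCast_eq_zero_iff _ q).2 (Nat.dvd_of_mod_eq_zero hD)
  push_cast at e
  exact e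

/-- Worked instance (`m = 25`, composite): with `q = 101` (`≡ 1 mod 25`) and `r = 5` of multiplicative order `25` mod `101`,
the key `F = δ₀ + δ₅ + δ₁₀ + δ₁₅ + δ₂₀` (indicator of the subgroup `5ℤ/25ℤ`) has `A = B = Σ_{j<5} r^{5j} ≡ 0`, so `A² + AB + B² ≡ 0`:
it carries no solution of the line identity. [folklore] -/
theorem unitCert_example : unitCert 25 (fun v : ZMod 25 => if v.val % 5 = 0 then 1 else 0) 101 5 = true := by
  decide +kernel

end Cert

end LineM

end Summit.MatrixMultiplication.OmegaCensus
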